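import Summits.BirchSwinnertonDyer.BirchSwinnertonDyer.Theorems.SchneiderFreeAdditiveX3AnticycControlAdditiveRankOneIndicesAnyTorsion
import HarnessLib

/-!
# Crux `AnticycControlAdditiveK` (route `SchneiderFreeAdditiveX3`, item stmt-BirchSwinnertonDyer-19295),
# stub `stub_baseCountTors` (P6-add-tors) on regime B2 (`E(K)[p] ≠ 0`) — part 3b: THE LOCAL INDEX
# `[G : p^k G + f(A)] · #A[p^∞] = p^{v(Ψ fQ)}` WITH rational `p`-torsion (pure algebra)

Seat `bsd-schneider-door-c6`, gen 2 (cell `bsd-schneider-ideate`). Setting of multr1-p2's `ZpLineIndex*`: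
`G ⊇ E ≅ ℤ_p` of finite index (for the count: `G = E(ℚ_p)`, `E = E⁽²⁾(ℚ_p)`), `Ψ = psi E φ`,
`Ψ(G) = p^m ℤ_p`, `p^m = #G[p^∞]`; `f : A →+ G` injective from a rank-one group `A` (`c Q = 1`, `ker c` =
the finite torsion `T`; for the count `A = E(K)`), `e = v(Ψ fQ)`. multr1-p2's exact local index
`[G : p^kG + ℤ fQ] = p^e` (`k ≥ e`) becomes, for the FULL image `f(A) = ℤ fQ + f(T)`:

* `eq_zero_of_mem_sup_of_prime_nsmul_eq_zero` — `p^kG + ℤ fQ` has no `p`-torsion (`k ≥ e`);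
* `range_nsmul_sup_range_eq_sup_map_torsion`, `natCard_primaryComponent_map_torsion_eq`;
* **`index_range_nsmul_sup_range_mul_natCard_eq`** — `[G : p^k G + f(A)] · #A[p^∞] = p^e` (`k ≥ e`):
  JSW17's `#δ_v = [E(K_v) : im E(K) + p^k E(K_v)]` DROPS by `#E(K)[p^∞]` — exactly compensating
  `[E(K) : p^k E(K)] = p^k · #E(K)[p^∞]` (part 3a) inside the level count (part 1).

Theorems only; no `Prop` fact; closes nothing by itself; BSD is not proved by any of this.
References: [JetchevSkinnerWan2017] Prop. 3.2.1, (7.1.5) (arXiv:1512.06894 pp. 10–11, 16); [Castella2018]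
proof of Thm. 2.3 (calcul) (arXiv:1704.06608 p. 6); [SilvermanAEC2009] VII.6.3.
-/

noncomputable section

open scoped Classical

set_option linter.dupNamespace false

namespace Summit.BirchSwinnertonDyer.BirchSwinnertonDyer.Theorems.SchneiderFreeAdditiveX3

open Summit.BirchSwinnertonDyer.Rank1Residual.X11b

/-! ## §3. The local index `[G : p^k G + f(A)]` with torsion -/

section Local

variable {p : ℕ} [Fact p.Prime] {G : Type*} [AddCommGroup G] (E : AddSubgroup G) [hE : E.FiniteIndex]
  (φ : E ≃+ ℤ_[p]) {m : ℕ}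
  (hm : (LocalIndex.psi E φ).range = (Ideal.span {(p : ℤ_[p]) ^ m}).toAddSubgroup)
  (hmcard : p ^ m = Nat.card (AddCommGroup.primaryComponent G p))

include hm hmcard in
/-- **`p^k G + ℤQ` has NO `p`-torsion for `k ≥ v(ΨQ)`** (`Q` of infinite order, `Ψ(G) = p^m ℤ_p`,
`p^m = #G[p^∞]`): `p • (p^k g + c Q) = 0` forces `p^m ∣ c` (valuations), so the element is `p^m y` with
`p^{m+1} y = 0`, `y ∈ G[p^∞]` of order `p^m`. [cite: Castella2018, proof of Thm. 2.3, (calcul) (arXiv:1704.06608 p. 6)] -/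
theorem eq_zero_of_mem_sup_of_prime_nsmul_eq_zero (Q : G) (hQ : ¬ IsOfFinAddOrder Q) {k : ℕ}
    (hk : (LocalIndex.psi E φ Q).valuation ≤ k) {b : G}
    (hb : b ∈ (nsmulAddMonoidHom (p ^ k) : G →+ G).range ⊔ AddSubgroup.zmultiples Q)
    (hpb : p • b = 0) : b = 0 := by
  have hp : p.Prime := Fact.out
  haveI : Finite (AddCommGroup.primaryComponent G p) := LocalIndex.finite_primaryComponent E φ
  set f := LocalIndex.psi E φ with hf
  set eQ := (f Q).valuation with heQ
  have hx : f Q ≠ 0 := fun h ↦ hQ ((LocalIndex.psi_eq_zero_iff E φ Q).mp h)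
  have hme : m ≤ eQ := LocalIndex.le_valuation_psi E φ hm Q hQ
  have hmk : m ≤ k := hme.trans hk
  obtain ⟨a, ⟨g, rfl⟩, b', hb', hsum⟩ := AddSubgroup.mem_sup.mp hb
  obtain ⟨c, rfl⟩ := AddSubgroup.mem_zmultiples_iff.mp hb'
  rw [nsmulAddMonoidHom_apply] at hsum
  -- `b` is torsion, so `Ψ b = 0`: `(-c : ℤ_p) · ΨQ = p^k Ψ g`
  have hbt : IsOfFinAddOrder b := isOfFinAddOrder_iff_nsmul_eq_zero.mpr ⟨p, hp.pos, hpb⟩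
  have hft : f b = 0 := (LocalIndex.psi_eq_zero_iff E φ b).mpr hbt
  have hrel : (((-c : ℤ)) : ℤ_[p]) * f Q = (p : ℤ_[p]) ^ k * f g := by
    have h := hft
    rw [← hsum, map_add, map_nsmul, map_zsmul, nsmul_eq_mul, zsmul_eq_mul, Nat.cast_pow] at h
    rw [Int.cast_neg]
    linear_combination -h
  -- `p^m ∣ c`
  have hcm : ((c : ℤ) : ℤ_[p]) ∈ (Ideal.span {(p : ℤ_[p]) ^ m}).toAddSubgroup := by
    have hneg : ((-c : ℤ) : ℤ_[p]) ∈ (Ideal.span {(p : ℤ_[p]) ^ m}).toAddSubgroup := by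
      by_cases hc0 : ((-c : ℤ) : ℤ_[p]) = 0
      · rw [hc0]; exact AddSubgroup.zero_mem _
      · have hfg : f g ≠ 0 := by
          intro h0
          rw [h0, mul_zero] at hrel
          exact hc0 ((mul_eq_zero.mp hrel).resolve_right hx)
        have hvg : m ≤ (f g).valuation := by
          have hmem : f g ∈ f.range := ⟨g, rfl⟩
          rw [hf, hm] at hmem
          exact LocalIndex.le_valuation_of_mem_span_pow hfg hmem
        have hv1 : ((((-c : ℤ)) : ℤ_[p]) * f Q).valuation = (((-c : ℤ)) : ℤ_[p]).valuation + eQ :=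
          PadicInt.valuation_mul hc0 hx
        have hv2 : ((((-c : ℤ)) : ℤ_[p]) * f Q).valuation = k + (f g).valuation := by
          rw [hrel, PadicInt.valuation_p_pow_mul k (f g) hfg]
        have hvc : m ≤ (((-c : ℤ)) : ℤ_[p]).valuation := by omega
        exact LocalIndex.mem_span_pow_of_le_valuation hc0 hvc
    have h2 : ((c : ℤ) : ℤ_[p]) = -(((-c : ℤ)) : ℤ_[p]) := by push_cast; ring
    rw [h2]
    exact AddSubgroup.neg_mem _ hneg
  obtain ⟨c₁, hc₁⟩ := LocalIndex.pow_dvd_of_intCast_mem_span hcm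
  -- `b = p^m • y`
  set y : G := p ^ (k - m) • g + c₁ • Q with hy
  have hby : b = p ^ m • y := by
    rw [hy, smul_add, smul_smul, ← pow_add, Nat.add_sub_cancel' hmk, ← hsum, hc₁, mul_zsmul',
      natCast_zsmul, smul_comm (p ^ m) c₁ Q]
  -- `p^{m+1} y = 0`, so `y ∈ G[p^∞]`, of order `p^m`: `p^m y = 0`
  have hyP : y ∈ AddCommGroup.primaryComponent G p := by
    refine (AddCommGroup.mem_primaryComponent).mpr ⟨m + 1, ?_⟩
    rw [pow_succ, mul_comm, mul_smul, ← hby, hpb]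
  have h0 : Nat.card (AddCommGroup.primaryComponent G p) •
      (⟨y, hyP⟩ : AddCommGroup.primaryComponent G p) = 0 := card_nsmul_eq_zero'
  rw [← hmcard] at h0
  rw [hby]
  exact congrArg Subtype.val h0

variable {A : Type*} [AddCommGroup A] (f : A →+ G) (hf : Function.Injective f)
  (c : A →+ ℤ) (Q : A) (hQ : c Q = 1) (hker : ∀ x : A, c x = 0 → IsOfFinAddOrder x)

omit hE [Fact p.Prime] in
include hQ hker in
/-- `p^k G + f(A) = (p^k G + ℤ f(Q)) + f(T)` for a rank-one `A` (`a = c(a) Q + t`). [folklore] -/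
theorem range_nsmul_sup_range_eq_sup_map_torsion (k : ℕ) :
    (nsmulAddMonoidHom (p ^ k) : G →+ G).range ⊔ f.range =
      ((nsmulAddMonoidHom (p ^ k) : G →+ G).range ⊔ AddSubgroup.zmultiples (f Q)) ⊔
        (AddCommGroup.torsion A).map f := by
  apply le_antisymm
  · refine sup_le (le_sup_left.trans le_sup_left) ?_
    rintro _ ⟨a, rfl⟩
    have ha : f a = c a • f Q + f (a - c a • Q) := by rw [map_sub, map_zsmul]; abel
    rw [ha]
    refine AddSubgroup.add_mem _ (AddSubgroup.mem_sup_left (AddSubgroup.mem_sup_right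
      (AddSubgroup.zsmul_mem _ (AddSubgroup.mem_zmultiples _) _))) (AddSubgroup.mem_sup_right ?_)
    exact ⟨a - c a • Q,
      (AddCommGroup.mem_torsion _).mpr (RankOne.isOfFinAddOrder_sub_coord_zsmul c Q hQ hker a), rfl⟩
  · refine sup_le (sup_le le_sup_left ?_) ?_
    · exact AddSubgroup.zmultiples_le.mpr (AddSubgroup.mem_sup_right ⟨Q, rfl⟩)
    · rintro _ ⟨t, -, rfl⟩
      exact AddSubgroup.mem_sup_right ⟨t, rfl⟩

include hf in
/-- `#f(T)[p^∞] = #A[p^∞]` for `f` injective (`T` the torsion of `A`). [folklore] -/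
theorem natCard_primaryComponent_map_torsion_eq :
    Nat.card (AddCommGroup.primaryComponent ↥((AddCommGroup.torsion A).map f) p) =
      Nat.card (AddCommGroup.primaryComponent A p) := by
  symm
  refine Nat.card_congr (Equiv.ofBijective (fun a ↦ ⟨⟨f (a : A), ⟨(a : A), ?_, rfl⟩⟩, ?_⟩) ⟨?_, ?_⟩)
  · obtain ⟨n, hn⟩ := (AddCommGroup.mem_primaryComponent).mp a.2
    exact (AddCommGroup.mem_torsion _).mpr (isOfFinAddOrder_iff_nsmul_eq_zero.mpr
      ⟨p ^ n, pow_pos (Fact.out : p.Prime).pos n, hn⟩)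
  · obtain ⟨n, hn⟩ := (AddCommGroup.mem_primaryComponent).mp a.2
    exact (AddCommGroup.mem_primaryComponent).mpr ⟨n, Subtype.ext (by
      change p ^ n • f (a : A) = 0
      rw [← map_nsmul, hn, map_zero])⟩
  · intro a b hab
    have h := congrArg (fun z : AddCommGroup.primaryComponent ↥((AddCommGroup.torsion A).map f) p ↦
      (((z : ↥((AddCommGroup.torsion A).map f)) : G))) hab
    exact Subtype.ext (hf h)
  · rintro ⟨⟨_, t, ht, rfl⟩, hx⟩
    obtain ⟨n, hn⟩ := (AddCommGroup.mem_primaryComponent).mp hx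
    have htn : p ^ n • t = 0 := hf (by
      rw [map_nsmul, map_zero]
      have h := congrArg (fun z : ↥((AddCommGroup.torsion A).map f) ↦ (z : G)) hn
      simpa using h)
    exact ⟨⟨t, (AddCommGroup.mem_primaryComponent).mpr ⟨n, htn⟩⟩, rfl⟩

include hm hmcard hf hQ hker in
/-- **THE LOCAL INDEX WITH TORSION: `[G : p^k G + f(A)] · #A[p^∞] = p^{v(Ψ fQ)}` for `k ≥ v(Ψ fQ)`**
(`f : A →+ G` injective, `A` rank one with finite torsion `T`, `G ⊇ E ≅ ℤ_p` of finite index,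
`Ψ(G) = p^m ℤ_p`, `p^m = #G[p^∞]`): with `H = p^kG + ℤ f(Q)` (index `p^{v(Ψ fQ)}`) and `B = f(T)`,
`p^kG + f(A) = H + B`, `[H + B : H] = [B : B ∩ H] = #B[p^∞]` (§1: `B ∩ H ⊇ p^m B` has no `p`-torsion).
For `G = E(ℚ_p)`, `A = E(K)`: JSW17's `#δ_v` drops by `#E(K)[p^∞]`.
[cite: JetchevSkinnerWan2017, Prop. 3.2.1 and (7.1.5) (arXiv:1512.06894 pp. 10–11, 16)]
[cite: Castella2018, proof of Thm. 2.3, (3.2.1) and (calcul) (arXiv:1704.06608 pp. 5–6)] -/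
theorem index_range_nsmul_sup_range_mul_natCard_eq [Finite (AddCommGroup.torsion A)] {k : ℕ}
    (hk : (LocalIndex.psi E φ (f Q)).valuation ≤ k) :
    ((nsmulAddMonoidHom (p ^ k) : G →+ G).range ⊔ f.range).index *
        Nat.card (AddCommGroup.primaryComponent A p) =
      p ^ (LocalIndex.psi E φ (f Q)).valuation := by
  have hp : p.Prime := Fact.out
  haveI : Finite (AddCommGroup.primaryComponent G p) := LocalIndex.finite_primaryComponent E φ
  set H := (nsmulAddMonoidHom (p ^ k) : G →+ G).range ⊔ AddSubgroup.zmultiples (f Q) with hH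
  set B := (AddCommGroup.torsion A).map f with hB
  haveI : Finite B := Finite.of_surjective (fun t : AddCommGroup.torsion A ↦
    (⟨f t, ⟨t, t.2, rfl⟩⟩ : B)) (by rintro ⟨_, t, ht, rfl⟩; exact ⟨⟨t, ht⟩, rfl⟩)
  have hQinf : ¬ IsOfFinAddOrder Q := fun h ↦ by
    have h0 := RankOne.coord_eq_zero_of_isOfFinAddOrder c h
    rw [hQ] at h0
    exact one_ne_zero h0
  have hxinf : ¬ IsOfFinAddOrder (f Q) := fun h ↦ hQinf ((hf.isOfFinAddOrder_iff).mp h)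
  -- `[G : H] = p^e`
  have hidx : H.index = p ^ (LocalIndex.psi E φ (f Q)).valuation :=
    LocalIndex.index_range_nsmul_sup_zmultiples_eq_pow_valuation E φ hm hmcard (f Q) hxinf hk
  -- `[B : B ∩ H] = #A[p^∞]`
  have hcount : Nat.card ↥(H.addSubgroupOf B) * Nat.card (AddCommGroup.primaryComponent A p) =
      Nat.card B := by
    rw [← natCard_primaryComponent_map_torsion_eq f hf]
    refine natCard_mul_natCard_primaryComponent_eq p m (H.addSubgroupOf B) ?_ ?_ ?_
    · intro x hx hpx
      rw [AddSubgroup.mem_addSubgroupOf] at hx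
      have h := eq_zero_of_mem_sup_of_prime_nsmul_eq_zero E φ hm hmcard (f Q) hxinf hk hx
        (by have h' := congrArg (fun z : B ↦ (z : G)) hpx; simpa using h')
      exact Subtype.ext h
    · intro x hx
      obtain ⟨n, hn⟩ := (AddCommGroup.mem_primaryComponent).mp hx
      have hxP : (x : G) ∈ AddCommGroup.primaryComponent G p :=
        (AddCommGroup.mem_primaryComponent).mpr ⟨n, by
          have h' := congrArg (fun z : B ↦ (z : G)) hn; simpa using h'⟩
      have h0 : Nat.card (AddCommGroup.primaryComponent G p) •
          (⟨(x : G), hxP⟩ : AddCommGroup.primaryComponent G p) = 0 := card_nsmul_eq_zero'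
      rw [← hmcard] at h0
      have h1 : p ^ m • (x : G) = 0 := by simpa using congrArg Subtype.val h0
      exact Subtype.ext (by simpa using h1)
    · rintro ⟨_, t, ht, rfl⟩
      rw [AddSubgroup.mem_addSubgroupOf]
      change p ^ m • f t ∈ H
      exact AddSubgroup.mem_sup_left (LocalIndex.pow_card_primary_nsmul_mem_range_of_isOfFinAddOrder
        E φ hmcard (f.isOfFinAddOrder ((AddCommGroup.mem_torsion _).mp ht)) k)
  have hrelB : H.relIndex B = Nat.card (AddCommGroup.primaryComponent A p) := by
    have h := AddSubgroup.card_mul_index (H.addSubgroupOf B)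
    rw [← hcount] at h
    exact Nat.eq_of_mul_eq_mul_left Nat.card_pos h
  -- `[G : H] = [G : H ⊔ B] · [H ⊔ B : H]`
  have h1 : H.relIndex (H ⊔ B) * (H ⊔ B).index = H.index := AddSubgroup.relIndex_mul_index le_sup_left
  rw [AddSubgroup.relIndex_sup_left, hrelB, hidx] at h1
  rw [range_nsmul_sup_range_eq_sup_map_torsion f c Q hQ hker k, ← hH, ← hB, mul_comm]
  exact h1

end Local

end Summit.BirchSwinnertonDyer.BirchSwinnertonDyer.Theorems.SchneiderFreeAdditiveX3

end
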